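import Summits.QuantumAdvantage.QuantumAdvantage.Theorems.ClusterLawB

set_option linter.dupNamespace false

/-!
# Cluster law, part C (lens 4, g28): the CLUSTER CERTIFICATE — labels and offsets (S-PRIME §12, STEP 2 ⟹ STEP 3)

The form in which the run dichotomy `(c0)_s` quotes the cluster lemma.  Inputs `x : X` (the points of a class cube) carry a pencil value
`qB x ∈ 𝔽_p^r` and a label `lab x ∈ L`; register `j` reads `A j ⬝ᵥ qB x + c j (lab x)` through a label-dependent table `T j (lab x)`, and the XOR
strategy is perfect against a label-dependent target `h (lab x)`.  If the pencil-and-label map is ONTO (every pencil value occurs together with every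
attained label — the output of the equidistribution step) and the functionals are pairwise non-parallel, then for every attained label every table
`T j l` is CONSTANT (`cluster_certificate`): each cluster is certified, label by label.
-/

namespace Summit.QuantumAdvantage.QuantumAdvantage.Theorems.ClusterLaw

open Finset

variable {p : ℕ} [Fact p.Prime]

/-- shifting the argument of a table by a constant offset preserves constancy -/
theorem const_of_shift_const (T : ZMod p → ZMod 2) (c : ZMod p) (h : ∀ z, T (z + c) = T (0 + c)) (y : ZMod p) : T y = T 0 := by
  have h1 := h (y - c)
  have h2 := h (0 - c)
  rw [sub_add_cancel] at h1 h2
  rw [h1, ← h2]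

/-- **CLUSTER CERTIFICATE.**  Perfect XOR play of registers reading pairwise non-parallel pencil members with label-dependent offsets, tables and
target, on a point set whose pencil-and-label map is onto ⇒ for every attained label, every table is constant. -/
theorem cluster_certificate (hp : p ≠ 2) {r m : ℕ} (A : Fin m → (Fin r → ZMod p)) (hA0 : ∀ j, A j ≠ 0)
    (hA : ∀ j j', j ≠ j' → ∀ c : ZMod p, A j ≠ c • A j') (J : Finset (Fin m))
    {X L : Type*} (qB : X → (Fin r → ZMod p)) (lab : X → L)
    (honto : ∀ (q : Fin r → ZMod p) (l : L), (∃ x, lab x = l) → ∃ x, qB x = q ∧ lab x = l)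
    (T : Fin m → L → ZMod p → ZMod 2) (c : Fin m → L → ZMod p) (h : L → ZMod 2)
    (hwin : ∀ x, ∑ j ∈ J, T j (lab x) (A j ⬝ᵥ qB x + c j (lab x)) = h (lab x)) :
    ∀ l, (∃ x, lab x = l) → ∀ j ∈ J, ∀ y, T j l y = T j l 0 := by
  intro l hl j hj y
  -- the functional equation for the shifted tables at label `l`
  have hFE : ∀ q, ∑ j ∈ J, (fun z => T j l (z + c j l)) (A j ⬝ᵥ q) = h l := by
    intro q
    obtain ⟨x, hxq, hxl⟩ := honto q l hl
    have := hwin x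
    rw [hxl, hxq] at this
    exact this
  have hconst := cluster_lemma hp A hA0 hA J (fun j z => T j l (z + c j l)) (h l) hFE j hj
  exact const_of_shift_const (T j l) (c j l) hconst y

end Summit.QuantumAdvantage.QuantumAdvantage.Theorems.ClusterLaw
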